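import Literature.Topology.FourManifolds.DehnSurgery
import Literature.Topology.FourManifolds.SurgeryGluck
import Literature.Topology.FourManifolds.ClosedBallProofs
import HarnessLib

/-!
# The `3`-sphere is surgery on the empty link; surgery presentations transport along diffeomorphisms

Topic `Literature/Topology/FourManifolds` (fact seat `provefact-Literature.SPC4.exists_isIntegralSurgeryLink`,
the Lickorish–Wallace theorem `Literature.Topology.FourManifolds.exists_isIntegralSurgeryLink`, **spc4.S22**,
`SurgeryGluck.lean`).  Two small **proved** facts about the relational surgery predicate
`Literature.Topology.FourManifolds.IsIntegralSurgeryLink` (`DehnSurgery.lean`; Rolfsen, *Knots and Links* (1976), §9.F–G):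

* `Literature.Topology.FourManifolds.isIntegralSurgeryLink_sphere_of_isEmpty`: `S³` is the result of surgery on a link with no
  components (the docstring of `Literature.Topology.FourManifolds.exists_isIntegralSurgeryLink`: "For `Y = 𝕊 3` take the
  empty link (`k = 0`)"; Rolfsen (1976), §9.F; this is also the base case `g = id` of
  Lickorish's realisation of a product of twists by surgeries, *Ann. of Math.* 76 (1962),
  p. 539): the complement of the empty link is all of `S³`, embedded by the inclusion of an open
  subset (`Manifold.IsSmoothEmbedding.of_opens`), and there are no solid tori to glue in.  Hence
  the conclusion of **spc4.S22** holds for `Y = 𝕊 3`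
  (`Literature.Topology.FourManifolds.exists_isIntegralSurgeryLink_sphere`) — non-vacuity of the target statement.
* `Literature.Topology.FourManifolds.IsIntegralSurgeryLink.of_diffeomorph`: if `Y` is surgery on the framed link `(L, m)` and
  `e : Y ≅ Y'` is a diffeomorphism (same model), then so is `Y'` (compose the gluing embeddings
  with `e`; `Manifold.IsSmoothEmbedding.diffeomorph_comp`, `ClosedBallProofs.lean`).  In
  particular every smooth `3`-manifold diffeomorphic to `𝕊 3` satisfies the conclusion of
  **spc4.S22** (`Literature.Topology.FourManifolds.exists_isIntegralSurgeryLink_of_diffeomorph_sphere`); this transport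
  is the last step of Lickorish's proof ("so `M` is homeomorphic to `S³` from which … solid tori
  have been removed, and are sewn back differently", p. 539), where `M ≅ hT₁ ∪_f T₂`.

## References

* D. Rolfsen, *Knots and Links*, Publish or Perish (1976), §9.F–G. [Rolfsen1976]
* W. B. R. Lickorish, *A representation of orientable combinatorial 3-manifolds*, Ann. of Math.
  76 (1962), proof of Thm. 2, p. 539. [LickorishAnnals1962]
-/

open scoped Manifold ContDiff Topology
open Function Set

noncomputable section

universe u

namespace Literature.Topology.FourManifolds

/-- Local notation: `𝔼 n` is the model Euclidean space `EuclideanSpace ℝ (Fin n)`. -/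
local notation "𝔼 " n:arg => EuclideanSpace ℝ (Fin n)
/-- Local notation: `𝕊 n` is the unit sphere in `EuclideanSpace ℝ (Fin (n + 1))`. -/
local notation "𝕊 " n:arg => (Metric.sphere (0 : EuclideanSpace ℝ (Fin (n + 1))) 1)

attribute [local instance] fact_finrank_euclideanSpace_succ

/-! ### Transport along diffeomorphisms -/

section Transport

variable {EY HY : Type*} [NormedAddCommGroup EY] [NormedSpace ℝ EY] [TopologicalSpace HY]
  {IY : ModelWithCorners ℝ EY HY} {Y : Type*} [TopologicalSpace Y] [ChartedSpace HY Y]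
  {Y' : Type*} [TopologicalSpace Y'] [ChartedSpace HY Y']

/-- **A surgery presentation transports along a diffeomorphism.**  If `Y` is integral surgery
on the framed link `(L, m)` (`Literature.Topology.FourManifolds.IsIntegralSurgeryLink`) and `e : Y ≅ Y'` is a diffeomorphism
between manifolds with the same model, then `Y'` is integral surgery on `(L, m)`: keep the
tubular neighbourhoods and compose the embeddings of the link complement and of the solid tori
with `e`.  Rolfsen (1976), §9.F (surgery descriptions are descriptions up to homeomorphism).
[cite: Rolfsen1976, §9.F] -/
theorem IsIntegralSurgeryLink.of_diffeomorph [IsManifold IY ∞ Y] [IsManifold IY ∞ Y']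
    {ι : Type*} [Finite ι] {L : Link ι} {m : ι → ℤ}
    (h : IsIntegralSurgeryLink IY Y L m) (e : Y ≃ₘ⟮IY, IY⟯ Y') : IsIntegralSurgeryLink IY Y' L m := by
  obtain ⟨ν, hν, hdisj, jA, jB, hA, hAo, hB, hcover, hdisjB, hrel⟩ := h
  refine ⟨ν, hν, hdisj, e ∘ jA, fun i => e ∘ jB i, hA.diffeomorph_comp e, ?_, fun i => ?_, ?_,
    ?_, fun i a b => ?_⟩
  · rw [range_comp]
    exact e.toHomeomorph.isOpenMap _ hAo
  · refine ⟨(hB i).1.diffeomorph_comp e, ?_⟩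
    rw [range_comp]
    exact e.toHomeomorph.isOpenMap _ (hB i).2
  · apply eq_univ_of_forall
    intro y
    have hy : e.symm y ∈ range jA ∪ ⋃ i, range (jB i) := by rw [hcover]; exact mem_univ _
    rcases hy with ⟨a, ha⟩ | hy
    · exact Or.inl ⟨a, by simp [ha]⟩
    · obtain ⟨i, b, hb⟩ := mem_iUnion.1 hy
      exact Or.inr (mem_iUnion.2 ⟨i, b, by simp [hb]⟩)
  · intro i j hij
    rw [range_comp, range_comp]
    exact (Set.disjoint_image_iff e.injective).2 (hdisjB hij)
  · rw [← hrel i a b]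
    exact e.injective.eq_iff

end Transport

/-! ### The empty link -/

section EmptyLink

/-- **`S³` is surgery on a link with no components**: the complement of such a link is all of
`S³`, smoothly embedded by the inclusion of an open subset, and no solid torus is glued in.
Rolfsen (1976), §9.F; Lickorish (1962), p. 539 (the case of no twists). [cite: Rolfsen1976, §9.F] -/
theorem isIntegralSurgeryLink_sphere_of_isEmpty {ι : Type*} [Finite ι] [IsEmpty ι] (L : Link ι)
    (m : ι → ℤ) : IsIntegralSurgeryLink (𝓡 3) (𝕊 3) L m := by
  refine ⟨fun i => isEmptyElim i, fun i => isEmptyElim i, fun i => isEmptyElim i,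
    Subtype.val, fun i => isEmptyElim i, Manifold.IsSmoothEmbedding.of_opens L.complement, ?_,
    fun i => isEmptyElim i, ?_, fun i => isEmptyElim i, fun i => isEmptyElim i⟩
  · rw [Subtype.range_coe_subtype]
    exact L.complement.isOpen
  · rw [iUnion_of_empty, union_empty]
    apply eq_univ_of_forall
    intro x
    refine ⟨⟨x, ?_⟩, rfl⟩
    rw [Link.mem_complement_iff]
    exact fun i => isEmptyElim i

/-- **The conclusion of spc4.S22 for `Y = S³`**: the `3`-sphere is integral surgery on a framed
link in `S³` — the empty link, `k = 0` (non-vacuity of `Literature.Topology.FourManifolds.exists_isIntegralSurgeryLink`;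
Rolfsen (1976), §9.F). [cite: Rolfsen1976, §9.F] -/
theorem exists_isIntegralSurgeryLink_sphere :
    ∃ (k : ℕ) (L : Link (Fin k)) (m : Fin k → ℤ), IsIntegralSurgeryLink (𝓡 3) (𝕊 3) L m :=
  ⟨0, ⟨Fin.elim0, fun i => i.elim0⟩, Fin.elim0, isIntegralSurgeryLink_sphere_of_isEmpty _ _⟩

/-- **The conclusion of spc4.S22 for every smooth `3`-manifold diffeomorphic to `S³`**
(transport along the diffeomorphism, `IsIntegralSurgeryLink.of_diffeomorph`; the final step of
Lickorish's proof of Thm. 2, p. 539, is such a transport). [cite: LickorishAnnals1962, proof of Thm. 2 (p. 539)] -/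
theorem exists_isIntegralSurgeryLink_of_diffeomorph_sphere (Y : Type u) [TopologicalSpace Y]
    [ChartedSpace (𝔼 3) Y] [IsManifold (𝓡 3) ∞ Y] (e : (𝕊 3) ≃ₘ⟮𝓡 3, 𝓡 3⟯ Y) :
    ∃ (k : ℕ) (L : Link (Fin k)) (m : Fin k → ℤ), IsIntegralSurgeryLink (𝓡 3) Y L m :=
  ⟨0, ⟨Fin.elim0, fun i => i.elim0⟩, Fin.elim0,
    (isIntegralSurgeryLink_sphere_of_isEmpty _ _).of_diffeomorph e⟩

end EmptyLink

end Literature.Topology.FourManifolds
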